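import Summits.Ventures.PercRepro.CatCount

/-!
# The branch-catalogue theorem — `Δ = catPoly` and the D-free inequality (module 8)

For a catalogue `C` of branch types with local graphs `loc` and multiplicities `m`, the (★)-slack of
the gadget `catGadget loc m` in the H-graph form of `dFreeIneq_iff_hGraph` —

`#{bot : c ~_H a avoiding L} + #{bot : c ~_H b avoiding K} − #{bot : a ~_H b}`

— is the CATALOGUE POLYNOMIAL `catPoly loc m = ∑ μ, ∑ ev, sign ev · ∑ U, moebius (Wcat μ ev) U ·
∏ τ, cT μ ev U τ ^ m τ` (`cat_delta`): the bot configurations are partitioned by their mode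
(`sum_modes_indicator`) and each cell is counted by `sum_indicator_eq_cellPoly`.  Hence the D-free
inequality holds on every gadget whose catalogue polynomial is nonnegative (`cat_dFreeIneq`) — the
nonnegativity of an explicit exponential polynomial is the only input per family.
-/

namespace PercRepro.CatGraph

open MultiGraph StarGadgetGraph Finset Classical

/-- A sum over the three events. -/
theorem sum_ev (f : Ev → ℤ) : ∑ ev : Ev, f ev = f .o1 + f .o2 + f .bad := by
  have h : (univ : Finset Ev) = {.o1, .o2, .bad} := by decide
  rw [h, Finset.sum_insert (by decide), Finset.sum_insert (by decide), Finset.sum_singleton]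
  ring

/-! ### The modes partition the bot configurations -/

section Modes

variable {C : Type} {BV BE : C → Type} {m : C → ℕ} (loc : ∀ τ, MultiGraph (Fin 4 ⊕ BV τ) (BE τ))

/-- The mode of a configuration: the mark the centre attaches to, if any. -/
noncomputable def modeOf (ω : Config (CE BE m)) : Mode :=
  if AttG loc ω 0 then some 0 else if AttG loc ω 1 then some 1 else if AttG loc ω 2 then some 2
  else none

/-- In a bot configuration the centre attaches to at most one mark. -/
theorem attG_unique {ω : Config (CE BE m)} (hb : (catGadget loc m).IsBot ω (vm 0) (vm 1) (vm 2))
    {m₁ m₂ : Fin 3} (h₁ : AttG loc ω m₁) (h₂ : AttG loc ω m₂) : m₁ = m₂ := by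
  obtain ⟨b₁, hb₁⟩ := h₁
  obtain ⟨b₂, hb₂⟩ := h₂
  exact ((isBot_iff_local loc ω).1 hb).2 b₁ b₂ m₁ m₂ hb₁ hb₂

/-- `InMode μ ω` iff `ω` is bot and `μ` is its mode. -/
theorem inMode_iff_modeOf (μ : Mode) (ω : Config (CE BE m)) :
    InMode loc μ ω ↔ (catGadget loc m).IsBot ω (vm 0) (vm 1) (vm 2) ∧ μ = modeOf loc ω := by
  constructor
  · rintro ⟨hb, hA⟩
    refine ⟨hb, ?_⟩
    unfold modeOf
    split_ifs with h0 h1 h2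
    · exact (hA 0).1 h0
    · exact (hA 1).1 h1
    · exact (hA 2).1 h2
    · rcases hμ : μ with _ | m'
      · rfl
      · exact absurd ((hA m').2 hμ) (by fin_cases m' <;> assumption)
  · rintro ⟨hb, rfl⟩
    refine ⟨hb, fun m' => ?_⟩
    unfold modeOf
    constructor
    · intro hm
      split_ifs with h0 h1 h2
      · rw [attG_unique loc hb h0 hm]
      · rw [attG_unique loc hb h1 hm]
      · rw [attG_unique loc hb h2 hm]
      · exact absurd hm (by fin_cases m' <;> assumption)
    · intro hm
      split_ifs at hm with h0 h1 h2
      · exact Option.some.inj hm ▸ h0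
      · exact Option.some.inj hm ▸ h1
      · exact Option.some.inj hm ▸ h2

/-- The indicator of «bot and `P`» splits over the modes. -/
theorem sum_modes_indicator (ω : Config (CE BE m)) (P : Prop)
    [Decidable ((catGadget loc m).IsBot ω (vm 0) (vm 1) (vm 2) ∧ P)]
    [∀ μ : Mode, Decidable (InMode loc μ ω ∧ P)] :
    (∑ μ : Mode, if InMode loc μ ω ∧ P then (1 : ℤ) else 0) =
      if (catGadget loc m).IsBot ω (vm 0) (vm 1) (vm 2) ∧ P then 1 else 0 := by
  by_cases hb : (catGadget loc m).IsBot ω (vm 0) (vm 1) (vm 2)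
  · by_cases hP : P
    · rw [if_pos ⟨hb, hP⟩, Finset.sum_eq_single (modeOf loc ω)]
      · rw [if_pos ⟨(inMode_iff_modeOf loc _ ω).2 ⟨hb, rfl⟩, hP⟩]
      · intro μ _ hμ
        rw [if_neg (fun h => hμ ((inMode_iff_modeOf loc μ ω).1 h.1).2)]
      · intro h
        exact absurd (Finset.mem_univ _) h
    · rw [if_neg (fun h => hP h.2)]
      exact Finset.sum_eq_zero fun μ _ => if_neg (fun h => hP h.2)
  · rw [if_neg (fun h => hb h.1)]
    exact Finset.sum_eq_zero fun μ _ => if_neg (fun h => hb h.1.1)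

end Modes

section Theorem

variable {C : Type} [Fintype C] [DecidableEq C] {BV BE : C → Type} [∀ τ, Fintype (BV τ)]
  [∀ τ, DecidableEq (BV τ)] [∀ τ, Fintype (BE τ)] [∀ τ, DecidableEq (BE τ)]
  (loc : ∀ τ, MultiGraph (Fin 4 ⊕ BV τ) (BE τ)) (m : C → ℕ)

/-- **The catalogue polynomial**: over the modes and the events, the Möbius combination of the
products of the per-type counts. -/
def catPoly : ℤ :=
  ∑ μ : Mode, ∑ ev : Ev, evSign ev *
    ∑ U : Finset (Fin 7), moebius (Wcat μ ev) U * ∏ τ, (cT loc μ (evX ev) U τ : ℤ) ^ m τ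

omit [DecidableEq C] in
/-- The catalogue polynomial is the signed sum of the cell polynomials. -/
theorem catPoly_eq : catPoly loc m = ∑ μ : Mode, ∑ ev : Ev, evSign ev * cellPoly loc (m := m) μ ev :=
  rfl

/-- **The bot configurations with the event `ev`** are counted by the sum of the cell polynomials
over the modes. -/
theorem card_bot_event (ev : Ev) :
    ((univ.filter fun ω : Config (CE BE m) =>
      (catGadget loc m).IsBot ω (vm 0) (vm 1) (vm 2) ∧ Event loc ev ω).card : ℤ) =
      ∑ μ : Mode, cellPoly loc (m := m) μ ev := by
  rw [Finset.card_filter, Nat.cast_sum]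
  simp only [Nat.cast_ite, Nat.cast_one, Nat.cast_zero]
  rw [← Finset.sum_congr rfl fun ω _ => sum_modes_indicator loc ω (Event loc ev ω)]
  rw [Finset.sum_comm]
  exact Finset.sum_congr rfl fun μ _ => sum_indicator_eq_cellPoly loc μ ev

/-- **The branch-catalogue theorem, graph half**: the (★)-slack of the gadget of a catalogue is its
catalogue polynomial. -/
theorem cat_delta :
    ((univ.filter fun ω : Config (CE BE m) =>
        (catGadget loc m).IsBot ω (vm 0) (vm 1) (vm 2) ∧
          (catGadget loc m).HConnAvoid ω (vm 2) ((catGadget loc m).cluster ω (vm 1))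
            (vm 2) (vm 0)).card : ℤ) +
      ((univ.filter fun ω : Config (CE BE m) =>
        (catGadget loc m).IsBot ω (vm 0) (vm 1) (vm 2) ∧
          (catGadget loc m).HConnAvoid ω (vm 2) ((catGadget loc m).cluster ω (vm 0))
            (vm 2) (vm 1)).card : ℤ) -
      ((univ.filter fun ω : Config (CE BE m) =>
        (catGadget loc m).IsBot ω (vm 0) (vm 1) (vm 2) ∧
          (catGadget loc m).HConn ω (vm 2) (vm 0) (vm 1)).card : ℤ) =
      catPoly loc m := by
  have c1 : (univ.filter fun ω : Config (CE BE m) =>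
      (catGadget loc m).IsBot ω (vm 0) (vm 1) (vm 2) ∧
        (catGadget loc m).HConnAvoid ω (vm 2) ((catGadget loc m).cluster ω (vm 1)) (vm 2) (vm 0)) =
      univ.filter fun ω : Config (CE BE m) =>
        (catGadget loc m).IsBot ω (vm 0) (vm 1) (vm 2) ∧ Event loc .o1 ω :=
    Finset.filter_congr fun ω _ => Iff.rfl
  have c2 : (univ.filter fun ω : Config (CE BE m) =>
      (catGadget loc m).IsBot ω (vm 0) (vm 1) (vm 2) ∧
        (catGadget loc m).HConnAvoid ω (vm 2) ((catGadget loc m).cluster ω (vm 0)) (vm 2) (vm 1)) =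
      univ.filter fun ω : Config (CE BE m) =>
        (catGadget loc m).IsBot ω (vm 0) (vm 1) (vm 2) ∧ Event loc .o2 ω :=
    Finset.filter_congr fun ω _ => Iff.rfl
  have c3 : (univ.filter fun ω : Config (CE BE m) =>
      (catGadget loc m).IsBot ω (vm 0) (vm 1) (vm 2) ∧
        (catGadget loc m).HConn ω (vm 2) (vm 0) (vm 1)) =
      univ.filter fun ω : Config (CE BE m) =>
        (catGadget loc m).IsBot ω (vm 0) (vm 1) (vm 2) ∧ Event loc .bad ω :=
    Finset.filter_congr fun ω _ => Iff.rfl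
  rw [c1, c2, c3, card_bot_event, card_bot_event, card_bot_event, catPoly_eq]
  have hev : ∀ μ : Mode, ∑ ev : Ev, evSign ev * cellPoly loc (m := m) μ ev =
      cellPoly loc (m := m) μ .o1 + cellPoly loc (m := m) μ .o2 - cellPoly loc (m := m) μ .bad := by
    intro μ
    rw [sum_ev]
    simp only [evSign]
    ring
  simp only [hev]
  rw [Finset.sum_sub_distrib, Finset.sum_add_distrib]

/-- **The branch-catalogue theorem**: the D-free inequality holds on the gadget of every catalogue
whose catalogue polynomial is nonnegative. -/
theorem cat_dFreeIneq (hP : 0 ≤ catPoly loc m) :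
    (catGadget loc m).DFreeIneq (vm 0) (vm 1) (vm 2) := by
  rw [dFreeIneq_iff_hGraph]
  have h := cat_delta loc m
  rw [← h] at hP
  have key : ((univ.filter fun ω : Config (CE BE m) =>
      (catGadget loc m).IsBot ω (vm 0) (vm 1) (vm 2) ∧
        (catGadget loc m).HConn ω (vm 2) (vm 0) (vm 1)).card : ℤ) ≤
      ((univ.filter fun ω : Config (CE BE m) =>
        (catGadget loc m).IsBot ω (vm 0) (vm 1) (vm 2) ∧
          (catGadget loc m).HConnAvoid ω (vm 2) ((catGadget loc m).cluster ω (vm 1))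
            (vm 2) (vm 0)).card : ℤ) +
        ((univ.filter fun ω : Config (CE BE m) =>
          (catGadget loc m).IsBot ω (vm 0) (vm 1) (vm 2) ∧
            (catGadget loc m).HConnAvoid ω (vm 2) ((catGadget loc m).cluster ω (vm 0))
              (vm 2) (vm 1)).card : ℤ) := by
    linarith
  exact_mod_cast key

end Theorem

end PercRepro.CatGraph
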